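import Summits.BirchSwinnertonDyer.BirchSwinnertonDyer.Theorems.KatoDescentPotSupersingularWildUpperUnitTwistRecordsSharpTam02
import Summits.BirchSwinnertonDyer.BirchSwinnertonDyer.Theorems.KatoDescentPotSupersingularWildUpperUnitTwistRecordsSharpTam03
import Literature.NumberTheory.EllipticCurves.ModThreeImageCubeDiscriminantProofs
import HarnessLib

/-!
# Route `KatoDescentPotSupersingular` (rung K9, sub-rung B5 = O6 wild `p = 3`, cell `bsd-potss`): MOD-3 IMAGE KERNEL UPGRADE of the ♯
# unit-twist records on the CARTAN rows — «`ρ̄_(E,3)` NOT onto» IN THE KERNEL from `Δ(E)` being a CUBE, so that the displayed binder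
# `hns` (3-adic tower not onto) is DISCHARGED on top of the Tamagawa upgrade (part 02: 19494x1@3, 22491bn1@3, 28566bg1@3, 32670k1@3, 32670j1@3, 32670bq1@3)
# (seat `bsd-potss-k9-c4` g17; `--supports stmt-BirchSwinnertonDyer-19197 --as helper`)

HONEST FRAMING. THEOREMS ONLY (no definition, no named fact, no `sorry`); PER PAIR; nothing booked; items 19189 / 19197 / 21422 stay
OPEN class-wide; BSD is not proved for any class.  The ♯ records display `hns : ¬ ∀ n, ρ̄_(E,3ⁿ) onto` — the row's mod-3 image
type (normaliser of a split / non-split Cartan) was so far a CENSUS DATUM (conjA-anchor g9 ROW-STATUS / kmc g21), not re-derived.  On a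
Cartan row the mod-3 image has order prime to 3, so `ℚ(∛Δ) ⊂ ℚ(E[3])` (Serre 1972 §5.3) forces `Δ(E) ∈ ℚ׳`; conversely the tree
THEOREM `ModThreeImage.not_hasSurjectiveModNGaloisRep_three_of_Δ_eq_cube` (`Literature/…/ModThreeImageCubeDiscriminantProofs`, PROVED,
no named fact) gives `Δ = s³ ⟹ ρ̄_(E,3)` not surjective, hence `hns`.  Per row below: `notSurjThree_g<label>` (`Δ(E₀) = s³` for the
literal integral model, `decide +kernel` + `norm_num`) and `missingUpperBoundAt_g<label>_3_img` = the Tamagawa-upgraded record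
`missingUpperBoundAt_g<label>_3_tam` (files `…RecordsSharpTamNN`, this seat) with `hns` REMOVED as well.  After this upgrade a ♯ record's
displayed row data are: the named facts + the schema, Cremona's `N`, `r_an = 0`, the lattice-optimal datum with `3 ∤ c(D)`, the field,
and the twist numerics — the image type and the Tamagawa data are kernel facts.  (The 9-deficient rows — `GL₂(𝔽₃)` onto mod 3, tower not
onto mod 9 — are NOT covered: `Δ` is not a cube there; their `hns` stays displayed.)

References: [Serre1972] §5.3; [SilvermanAEC2009] III.1, VII.1 Rem. 1.1; [Zywina2015ModL] §1 (images of ρ̄_(E,3)); [Jetchev2008] Cor. 1.5;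
[Miller2011LMS] Def. 1.1; [Cremona2006] Table 1.
-/

set_option autoImplicit false
set_option linter.dupNamespace false
noncomputable section
open scoped Classical NumberField
open WeierstrassCurve NumberField Field
  Literature.NumberTheory.EllipticCurves
  Literature.NumberTheory.EllipticCurves.ModularForms Literature.NumberTheory.EllipticCurves.Rank1Residual
  Literature.NumberTheory.EllipticCurves.Rank1Residual.Typed Literature.NumberTheory.Automorphic
  Literature.NumberTheory.EllipticCurves.Rank1Residual.X11RankOneCertificates
  Summit.BirchSwinnertonDyer.BirchSwinnertonDyer.Rank1Residual.IntModel
  Summit.BirchSwinnertonDyer.BirchSwinnertonDyer.Rank1Residual.X11RankOne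
  Summit.BirchSwinnertonDyer.Rank1Residual Summit.BirchSwinnertonDyer.Rank1Residual.Additive
  Summit.BirchSwinnertonDyer.BirchSwinnertonDyer.Theorems

namespace Summit.BirchSwinnertonDyer.BirchSwinnertonDyer.Theorems.WildUpperUnitTwistRecords

/-! ### `19494x1`: `Δ = 852478793130085497962496 = (94818816)³` — mod-3 image inside a Cartan normaliser, certified in the kernel -/

/-- **`ρ̄_(E,3)` is NOT surjective for `E = 19494x1`** (kernel: `Δ(E) = (94818816)³` on the integral model `[1, -1, 1, -57074168, 159920200315]`; Serre: `ℚ(E[3]) ⊇ ℚ(μ₃, ∛Δ)`, so a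
surjective image forces `Δ ∉ ℚ׳`; tree THEOREM `ModThreeImage.not_hasSurjectiveModNGaloisRep_three_of_Δ_eq_cube`). [cite: Serre1972, §5.3]
[cite: SilvermanAEC2009, III.1] [cite: Cremona2006, Table 1 (Cremona label 19494x1)] -/
theorem notSurjThree_g19494x1 {W : WeierstrassCurve ℚ} [W.IsElliptic] [W.IsGloballyMinimal]
    (hI : integralModelInt W = (⟨1, -1, 1, -57074168, 159920200315⟩ : WeierstrassCurve ℤ)) : ¬ W.HasSurjectiveModNGaloisRep 3 := by
  have hD : discOf [1, (-1), 1, (-57074168), 159920200315] = 852478793130085497962496 := by decide +kernel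
  have hΔ : W.Δ = ((852478793130085497962496 : ℤ) : ℚ) := by rw [Δ_eq_cast hI, intCurve_Δ, hD]
  exact ModThreeImage.not_hasSurjectiveModNGaloisRep_three_of_Δ_eq_cube W (d := ((94818816 : ℤ) : ℚ)) (by rw [hΔ]; norm_num)

/-- **RECORD `19494x1` @ `3` with the image binder `hns` AND the Tamagawa binders DISCHARGED** — `missingUpperBoundAt_g19494x1_3_tam` (file
`…RecordsSharpTam02`) with `hns` supplied by `notSurjThree_g19494x1` (`n = 1`). Remaining displayed: named facts + schema, Cremona's `N`, `r_an = 0`,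
the lattice-optimal datum with `3 ∤ c(D)`, the field, the twist numerics. Per pair; nothing booked; BSD is not proved by this.
[cite: Serre1972, §5.3] [cite: Jetchev2008, Cor. 1.5] [cite: Miller2011LMS, Def. 1.1] [cite: Cremona2006, Table 1 (Cremona label 19494x1)] -/
theorem missingUpperBoundAt_g19494x1_3_img
    (hGZ : ∀ (N : ℕ) [NeZero N] (W : WeierstrassCurve ℚ) (K : Type) [Field K] [NumberField K],
      gross_zagier N W K)
    (hKo : ∀ (N : ℕ) [NeZero N] (W : WeierstrassCurve ℚ) (K : Type) [Field K] [NumberField K],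
      kolyvagin N W K)
    (hMN : ∀ (N : ℕ) [NeZero N] (W : WeierstrassCurve ℚ) (K : Type) [Field K] [NumberField K],
      MatarNekovar2019.thm03_padicValNat_card_sha_le_of_irreducible N W K)
    (hGZK : rank_eq_analyticRank_of_analyticRank_le_one) (hmod : hasEntireLFunction_rat)
    (hJ2 : ∀ (N : ℕ) [NeZero N] (W : WeierstrassCurve ℚ) [W.IsElliptic] [W.IsGloballyMinimal]
      (K : Type) [Field K] [NumberField K],
      IsImaginaryQuadratic K → NumberField.discr K ≠ -3 → NumberField.discr K ≠ -4 →
      SatisfiesHeegnerHypothesis N K → SatisfiesHeegnerHypothesis 2 K →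
      ∀ (p : ℕ) [Fact p.Prime], p ≠ 2 → W.analyticRank = 0 → Addv W p → 0 ≤ padicValRat p W.j →
      ¬ W.HasCM → W.HasIrreducibleModPGaloisRep p →
      ¬ (∀ n : ℕ, W.HasSurjectiveModNGaloisRep (p ^ n : ℕ)) →
      (∃ Dt : ModularParametrizationData W N,
        (∀ z ∈ Dt.L.lattice, ∃ w ∈ periodLattice Dt.f, z = (Dt.c : ℂ) * w) ∧ ¬ (p : ℤ) ∣ Dt.c) →
      ¬ p ∣ (W.baseChange ℚ_[p]).localTamagawaNumber ℤ_[p] →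
      (∀ (q' : ℕ) [Fact q'.Prime], q' ∣ N →
        p ∣ (W.baseChange ℚ_[q']).localTamagawaNumber ℤ_[q'] → ¬ q' ^ 2 ∣ N) →
      ∀ {P : (W.baseChange K).toAffine.Point}, IsHeegnerPoint N W K P → ¬ IsOfFinAddOrder P →
      ∀ (q : ℕ) [Fact q.Prime], q ∣ N → ¬ q ^ 2 ∣ N → q ≠ p →
      padicValNat p (Nat.card (AddCommGroup.primaryComponent (W.baseChange K).sha p)) +
          2 * padicValNat p ((W.baseChange ℚ_[q]).localTamagawaNumber ℤ_[q]) ≤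
        2 * padicValNat p (AddSubgroup.zmultiples P).index)
    {W : WeierstrassCurve ℚ} [W.IsElliptic] [W.IsGloballyMinimal] (hWeq : W = (⟨1, (-1), 1, (-57074168), 159920200315⟩ : WeierstrassCurve ℚ))
    (hN : W.conductorNorm ℤ = 19494) (hr : W.analyticRank = 0)
    (D : ModularParametrizationData W 19494) (hopt : ∀ z ∈ D.L.lattice, ∃ w ∈ periodLattice D.f, z = (D.c : ℂ) * w)
    (hc : ¬ (3 : ℤ) ∣ D.c)
    (K : Type) [Field K] [NumberField K] (hK : IsImaginaryQuadratic K) (hdK : NumberField.discr K = -71)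
    {Wd : WeierstrassCurve ℚ} [Wd.IsElliptic] [Wd.IsGloballyMinimal] (hWdeq : Wd = (⟨1, (-1), 1, (-287710879313), (-57232020019209407)⟩ : WeierstrassCurve ℚ))
    (hrd : Wd.analyticRank = 1) {qd : ℚ} (hqd : shaAn Wd = (qd : ℂ)) (hvd : padicValRat 3 qd ≤ 0) :
    MissingUpperBoundAt W 3 := by
  have hI : integralModelInt W = (⟨1, -1, 1, -57074168, 159920200315⟩ : WeierstrassCurve ℤ) := by
    subst hWeq; exact integralModelInt_eq_of_map_eq _ (map_mk_int 1 (-1) 1 (-57074168) 159920200315)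
  have hns : ¬ (∀ n : ℕ, W.HasSurjectiveModNGaloisRep (3 ^ n : ℕ)) := fun h =>
    notSurjThree_g19494x1 hI (by simpa using h 1)
  exact missingUpperBoundAt_g19494x1_3_tam hGZ hKo hMN hGZK hmod hJ2 hWeq hN hr hns D hopt hc K hK hdK hWdeq hrd hqd hvd

/-! ### `22491bn1`: `Δ = 5352946322157 = (17493)³` — mod-3 image inside a Cartan normaliser, certified in the kernel -/

/-- **`ρ̄_(E,3)` is NOT surjective for `E = 22491bn1`** (kernel: `Δ(E) = (17493)³` on the integral model `[0, 0, 1, -5145, -88237]`; Serre: `ℚ(E[3]) ⊇ ℚ(μ₃, ∛Δ)`, so a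
surjective image forces `Δ ∉ ℚ׳`; tree THEOREM `ModThreeImage.not_hasSurjectiveModNGaloisRep_three_of_Δ_eq_cube`). [cite: Serre1972, §5.3]
[cite: SilvermanAEC2009, III.1] [cite: Cremona2006, Table 1 (Cremona label 22491bn1)] -/
theorem notSurjThree_g22491bn1 {W : WeierstrassCurve ℚ} [W.IsElliptic] [W.IsGloballyMinimal]
    (hI : integralModelInt W = (⟨0, 0, 1, -5145, -88237⟩ : WeierstrassCurve ℤ)) : ¬ W.HasSurjectiveModNGaloisRep 3 := by
  have hD : discOf [0, 0, 1, (-5145), (-88237)] = 5352946322157 := by decide +kernel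
  have hΔ : W.Δ = ((5352946322157 : ℤ) : ℚ) := by rw [Δ_eq_cast hI, intCurve_Δ, hD]
  exact ModThreeImage.not_hasSurjectiveModNGaloisRep_three_of_Δ_eq_cube W (d := ((17493 : ℤ) : ℚ)) (by rw [hΔ]; norm_num)

/-- **RECORD `22491bn1` @ `3` with the image binder `hns` AND the Tamagawa binders DISCHARGED** — `missingUpperBoundAt_g22491bn1_3_tam` (file
`…RecordsSharpTam02`) with `hns` supplied by `notSurjThree_g22491bn1` (`n = 1`). Remaining displayed: named facts + schema, Cremona's `N`, `r_an = 0`,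
the lattice-optimal datum with `3 ∤ c(D)`, the field, the twist numerics. Per pair; nothing booked; BSD is not proved by this.
[cite: Serre1972, §5.3] [cite: Jetchev2008, Cor. 1.5] [cite: Miller2011LMS, Def. 1.1] [cite: Cremona2006, Table 1 (Cremona label 22491bn1)] -/
theorem missingUpperBoundAt_g22491bn1_3_img
    (hGZ : ∀ (N : ℕ) [NeZero N] (W : WeierstrassCurve ℚ) (K : Type) [Field K] [NumberField K],
      gross_zagier N W K)
    (hKo : ∀ (N : ℕ) [NeZero N] (W : WeierstrassCurve ℚ) (K : Type) [Field K] [NumberField K],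
      kolyvagin N W K)
    (hMN : ∀ (N : ℕ) [NeZero N] (W : WeierstrassCurve ℚ) (K : Type) [Field K] [NumberField K],
      MatarNekovar2019.thm03_padicValNat_card_sha_le_of_irreducible N W K)
    (hGZK : rank_eq_analyticRank_of_analyticRank_le_one) (hmod : hasEntireLFunction_rat)
    (hJ2 : ∀ (N : ℕ) [NeZero N] (W : WeierstrassCurve ℚ) [W.IsElliptic] [W.IsGloballyMinimal]
      (K : Type) [Field K] [NumberField K],
      IsImaginaryQuadratic K → NumberField.discr K ≠ -3 → NumberField.discr K ≠ -4 →
      SatisfiesHeegnerHypothesis N K → SatisfiesHeegnerHypothesis 2 K →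
      ∀ (p : ℕ) [Fact p.Prime], p ≠ 2 → W.analyticRank = 0 → Addv W p → 0 ≤ padicValRat p W.j →
      ¬ W.HasCM → W.HasIrreducibleModPGaloisRep p →
      ¬ (∀ n : ℕ, W.HasSurjectiveModNGaloisRep (p ^ n : ℕ)) →
      (∃ Dt : ModularParametrizationData W N,
        (∀ z ∈ Dt.L.lattice, ∃ w ∈ periodLattice Dt.f, z = (Dt.c : ℂ) * w) ∧ ¬ (p : ℤ) ∣ Dt.c) →
      ¬ p ∣ (W.baseChange ℚ_[p]).localTamagawaNumber ℤ_[p] →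
      (∀ (q' : ℕ) [Fact q'.Prime], q' ∣ N →
        p ∣ (W.baseChange ℚ_[q']).localTamagawaNumber ℤ_[q'] → ¬ q' ^ 2 ∣ N) →
      ∀ {P : (W.baseChange K).toAffine.Point}, IsHeegnerPoint N W K P → ¬ IsOfFinAddOrder P →
      ∀ (q : ℕ) [Fact q.Prime], q ∣ N → ¬ q ^ 2 ∣ N → q ≠ p →
      padicValNat p (Nat.card (AddCommGroup.primaryComponent (W.baseChange K).sha p)) +
          2 * padicValNat p ((W.baseChange ℚ_[q]).localTamagawaNumber ℤ_[q]) ≤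
        2 * padicValNat p (AddSubgroup.zmultiples P).index)
    {W : WeierstrassCurve ℚ} [W.IsElliptic] [W.IsGloballyMinimal] (hWeq : W = (⟨0, 0, 1, (-5145), (-88237)⟩ : WeierstrassCurve ℚ))
    (hN : W.conductorNorm ℤ = 22491) (hr : W.analyticRank = 0)
    (D : ModularParametrizationData W 22491) (hopt : ∀ z ∈ D.L.lattice, ∃ w ∈ periodLattice D.f, z = (D.c : ℂ) * w)
    (hc : ¬ (3 : ℤ) ∣ D.c)
    (K : Type) [Field K] [NumberField K] (hK : IsImaginaryQuadratic K) (hdK : NumberField.discr K = -47)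
    {Wd : WeierstrassCurve ℚ} [Wd.IsElliptic] [Wd.IsGloballyMinimal] (hWdeq : Wd = (⟨0, 0, 1, (-11365305), 9161004095⟩ : WeierstrassCurve ℚ))
    (hrd : Wd.analyticRank = 1) {qd : ℚ} (hqd : shaAn Wd = (qd : ℂ)) (hvd : padicValRat 3 qd ≤ 0) :
    MissingUpperBoundAt W 3 := by
  have hI : integralModelInt W = (⟨0, 0, 1, -5145, -88237⟩ : WeierstrassCurve ℤ) := by
    subst hWeq; exact integralModelInt_eq_of_map_eq _ (map_mk_int 0 0 1 (-5145) (-88237))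
  have hns : ¬ (∀ n : ℕ, W.HasSurjectiveModNGaloisRep (3 ^ n : ℕ)) := fun h =>
    notSurjThree_g22491bn1 hI (by simpa using h 1)
  exact missingUpperBoundAt_g22491bn1_3_tam hGZ hKo hMN hGZK hmod hJ2 hWeq hN hr hns D hopt hc K hK hdK hWdeq hrd hqd hvd

/-! ### `28566bg1`: `Δ = -2628072 = (-138)³` — mod-3 image inside a Cartan normaliser, certified in the kernel -/

/-- **`ρ̄_(E,3)` is NOT surjective for `E = 28566bg1`** (kernel: `Δ(E) = (-138)³` on the integral model `[1, -1, 1, -65, -199]`; Serre: `ℚ(E[3]) ⊇ ℚ(μ₃, ∛Δ)`, so a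
surjective image forces `Δ ∉ ℚ׳`; tree THEOREM `ModThreeImage.not_hasSurjectiveModNGaloisRep_three_of_Δ_eq_cube`). [cite: Serre1972, §5.3]
[cite: SilvermanAEC2009, III.1] [cite: Cremona2006, Table 1 (Cremona label 28566bg1)] -/
theorem notSurjThree_g28566bg1 {W : WeierstrassCurve ℚ} [W.IsElliptic] [W.IsGloballyMinimal]
    (hI : integralModelInt W = (⟨1, -1, 1, -65, -199⟩ : WeierstrassCurve ℤ)) : ¬ W.HasSurjectiveModNGaloisRep 3 := by
  have hD : discOf [1, (-1), 1, (-65), (-199)] = (-2628072) := by decide +kernel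
  have hΔ : W.Δ = (((-2628072) : ℤ) : ℚ) := by rw [Δ_eq_cast hI, intCurve_Δ, hD]
  exact ModThreeImage.not_hasSurjectiveModNGaloisRep_three_of_Δ_eq_cube W (d := (((-138) : ℤ) : ℚ)) (by rw [hΔ]; norm_num)

/-- **RECORD `28566bg1` @ `3` with the image binder `hns` AND the Tamagawa binders DISCHARGED** — `missingUpperBoundAt_g28566bg1_3_tam` (file
`…RecordsSharpTam03`) with `hns` supplied by `notSurjThree_g28566bg1` (`n = 1`). Remaining displayed: named facts + schema, Cremona's `N`, `r_an = 0`,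
the lattice-optimal datum with `3 ∤ c(D)`, the field, the twist numerics. Per pair; nothing booked; BSD is not proved by this.
[cite: Serre1972, §5.3] [cite: Jetchev2008, Cor. 1.5] [cite: Miller2011LMS, Def. 1.1] [cite: Cremona2006, Table 1 (Cremona label 28566bg1)] -/
theorem missingUpperBoundAt_g28566bg1_3_img
    (hGZ : ∀ (N : ℕ) [NeZero N] (W : WeierstrassCurve ℚ) (K : Type) [Field K] [NumberField K],
      gross_zagier N W K)
    (hKo : ∀ (N : ℕ) [NeZero N] (W : WeierstrassCurve ℚ) (K : Type) [Field K] [NumberField K],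
      kolyvagin N W K)
    (hMN : ∀ (N : ℕ) [NeZero N] (W : WeierstrassCurve ℚ) (K : Type) [Field K] [NumberField K],
      MatarNekovar2019.thm03_padicValNat_card_sha_le_of_irreducible N W K)
    (hGZK : rank_eq_analyticRank_of_analyticRank_le_one) (hmod : hasEntireLFunction_rat)
    (hJ2 : ∀ (N : ℕ) [NeZero N] (W : WeierstrassCurve ℚ) [W.IsElliptic] [W.IsGloballyMinimal]
      (K : Type) [Field K] [NumberField K],
      IsImaginaryQuadratic K → NumberField.discr K ≠ -3 → NumberField.discr K ≠ -4 →
      SatisfiesHeegnerHypothesis N K → SatisfiesHeegnerHypothesis 2 K →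
      ∀ (p : ℕ) [Fact p.Prime], p ≠ 2 → W.analyticRank = 0 → Addv W p → 0 ≤ padicValRat p W.j →
      ¬ W.HasCM → W.HasIrreducibleModPGaloisRep p →
      ¬ (∀ n : ℕ, W.HasSurjectiveModNGaloisRep (p ^ n : ℕ)) →
      (∃ Dt : ModularParametrizationData W N,
        (∀ z ∈ Dt.L.lattice, ∃ w ∈ periodLattice Dt.f, z = (Dt.c : ℂ) * w) ∧ ¬ (p : ℤ) ∣ Dt.c) →
      ¬ p ∣ (W.baseChange ℚ_[p]).localTamagawaNumber ℤ_[p] →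
      (∀ (q' : ℕ) [Fact q'.Prime], q' ∣ N →
        p ∣ (W.baseChange ℚ_[q']).localTamagawaNumber ℤ_[q'] → ¬ q' ^ 2 ∣ N) →
      ∀ {P : (W.baseChange K).toAffine.Point}, IsHeegnerPoint N W K P → ¬ IsOfFinAddOrder P →
      ∀ (q : ℕ) [Fact q.Prime], q ∣ N → ¬ q ^ 2 ∣ N → q ≠ p →
      padicValNat p (Nat.card (AddCommGroup.primaryComponent (W.baseChange K).sha p)) +
          2 * padicValNat p ((W.baseChange ℚ_[q]).localTamagawaNumber ℤ_[q]) ≤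
        2 * padicValNat p (AddSubgroup.zmultiples P).index)
    {W : WeierstrassCurve ℚ} [W.IsElliptic] [W.IsGloballyMinimal] (hWeq : W = (⟨1, (-1), 1, (-65), (-199)⟩ : WeierstrassCurve ℚ))
    (hN : W.conductorNorm ℤ = 28566) (hr : W.analyticRank = 0)
    (D : ModularParametrizationData W 28566) (hopt : ∀ z ∈ D.L.lattice, ∃ w ∈ periodLattice D.f, z = (D.c : ℂ) * w)
    (hc : ¬ (3 : ℤ) ∣ D.c)
    (K : Type) [Field K] [NumberField K] (hK : IsImaginaryQuadratic K) (hdK : NumberField.discr K = -143)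
    {Wd : WeierstrassCurve ℚ} [Wd.IsElliptic] [Wd.IsGloballyMinimal] (hWdeq : Wd = (⟨1, (-1), 1, (-1322795), 628761059⟩ : WeierstrassCurve ℚ))
    (hrd : Wd.analyticRank = 1) {qd : ℚ} (hqd : shaAn Wd = (qd : ℂ)) (hvd : padicValRat 3 qd ≤ 0) :
    MissingUpperBoundAt W 3 := by
  have hI : integralModelInt W = (⟨1, -1, 1, -65, -199⟩ : WeierstrassCurve ℤ) := by
    subst hWeq; exact integralModelInt_eq_of_map_eq _ (map_mk_int 1 (-1) 1 (-65) (-199))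
  have hns : ¬ (∀ n : ℕ, W.HasSurjectiveModNGaloisRep (3 ^ n : ℕ)) := fun h =>
    notSurjThree_g28566bg1 hI (by simpa using h 1)
  exact missingUpperBoundAt_g28566bg1_3_tam hGZ hKo hMN hGZK hmod hJ2 hWeq hN hr hns D hopt hc K hK hdK hWdeq hrd hqd hvd

/-! ### `32670k1`: `Δ = -509316701256000000000 = (-7986000)³` — mod-3 image inside a Cartan normaliser, certified in the kernel -/

/-- **`ρ̄_(E,3)` is NOT surjective for `E = 32670k1`** (kernel: `Δ(E) = (-7986000)³` on the integral model `[1, -1, 0, -12632604, -17312657840]`; Serre: `ℚ(E[3]) ⊇ ℚ(μ₃, ∛Δ)`, so a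
surjective image forces `Δ ∉ ℚ׳`; tree THEOREM `ModThreeImage.not_hasSurjectiveModNGaloisRep_three_of_Δ_eq_cube`). [cite: Serre1972, §5.3]
[cite: SilvermanAEC2009, III.1] [cite: Cremona2006, Table 1 (Cremona label 32670k1)] -/
theorem notSurjThree_g32670k1 {W : WeierstrassCurve ℚ} [W.IsElliptic] [W.IsGloballyMinimal]
    (hI : integralModelInt W = (⟨1, -1, 0, -12632604, -17312657840⟩ : WeierstrassCurve ℤ)) : ¬ W.HasSurjectiveModNGaloisRep 3 := by
  have hD : discOf [1, (-1), 0, (-12632604), (-17312657840)] = (-509316701256000000000) := by decide +kernel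
  have hΔ : W.Δ = (((-509316701256000000000) : ℤ) : ℚ) := by rw [Δ_eq_cast hI, intCurve_Δ, hD]
  exact ModThreeImage.not_hasSurjectiveModNGaloisRep_three_of_Δ_eq_cube W (d := (((-7986000) : ℤ) : ℚ)) (by rw [hΔ]; norm_num)

/-- **RECORD `32670k1` @ `3` with the image binder `hns` AND the Tamagawa binders DISCHARGED** — `missingUpperBoundAt_g32670k1_3_tam` (file
`…RecordsSharpTam03`) with `hns` supplied by `notSurjThree_g32670k1` (`n = 1`). Remaining displayed: named facts + schema, Cremona's `N`, `r_an = 0`,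
the lattice-optimal datum with `3 ∤ c(D)`, the field, the twist numerics. Per pair; nothing booked; BSD is not proved by this.
[cite: Serre1972, §5.3] [cite: Jetchev2008, Cor. 1.5] [cite: Miller2011LMS, Def. 1.1] [cite: Cremona2006, Table 1 (Cremona label 32670k1)] -/
theorem missingUpperBoundAt_g32670k1_3_img
    (hGZ : ∀ (N : ℕ) [NeZero N] (W : WeierstrassCurve ℚ) (K : Type) [Field K] [NumberField K],
      gross_zagier N W K)
    (hKo : ∀ (N : ℕ) [NeZero N] (W : WeierstrassCurve ℚ) (K : Type) [Field K] [NumberField K],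
      kolyvagin N W K)
    (hMN : ∀ (N : ℕ) [NeZero N] (W : WeierstrassCurve ℚ) (K : Type) [Field K] [NumberField K],
      MatarNekovar2019.thm03_padicValNat_card_sha_le_of_irreducible N W K)
    (hGZK : rank_eq_analyticRank_of_analyticRank_le_one) (hmod : hasEntireLFunction_rat)
    (hJ2 : ∀ (N : ℕ) [NeZero N] (W : WeierstrassCurve ℚ) [W.IsElliptic] [W.IsGloballyMinimal]
      (K : Type) [Field K] [NumberField K],
      IsImaginaryQuadratic K → NumberField.discr K ≠ -3 → NumberField.discr K ≠ -4 →
      SatisfiesHeegnerHypothesis N K → SatisfiesHeegnerHypothesis 2 K →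
      ∀ (p : ℕ) [Fact p.Prime], p ≠ 2 → W.analyticRank = 0 → Addv W p → 0 ≤ padicValRat p W.j →
      ¬ W.HasCM → W.HasIrreducibleModPGaloisRep p →
      ¬ (∀ n : ℕ, W.HasSurjectiveModNGaloisRep (p ^ n : ℕ)) →
      (∃ Dt : ModularParametrizationData W N,
        (∀ z ∈ Dt.L.lattice, ∃ w ∈ periodLattice Dt.f, z = (Dt.c : ℂ) * w) ∧ ¬ (p : ℤ) ∣ Dt.c) →
      ¬ p ∣ (W.baseChange ℚ_[p]).localTamagawaNumber ℤ_[p] →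
      (∀ (q' : ℕ) [Fact q'.Prime], q' ∣ N →
        p ∣ (W.baseChange ℚ_[q']).localTamagawaNumber ℤ_[q'] → ¬ q' ^ 2 ∣ N) →
      ∀ {P : (W.baseChange K).toAffine.Point}, IsHeegnerPoint N W K P → ¬ IsOfFinAddOrder P →
      ∀ (q : ℕ) [Fact q.Prime], q ∣ N → ¬ q ^ 2 ∣ N → q ≠ p →
      padicValNat p (Nat.card (AddCommGroup.primaryComponent (W.baseChange K).sha p)) +
          2 * padicValNat p ((W.baseChange ℚ_[q]).localTamagawaNumber ℤ_[q]) ≤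
        2 * padicValNat p (AddSubgroup.zmultiples P).index)
    {W : WeierstrassCurve ℚ} [W.IsElliptic] [W.IsGloballyMinimal] (hWeq : W = (⟨1, (-1), 0, (-12632604), (-17312657840)⟩ : WeierstrassCurve ℚ))
    (hN : W.conductorNorm ℤ = 32670) (hr : W.analyticRank = 0)
    (D : ModularParametrizationData W 32670) (hopt : ∀ z ∈ D.L.lattice, ∃ w ∈ periodLattice D.f, z = (D.c : ℂ) * w)
    (hc : ¬ (3 : ℤ) ∣ D.c)
    (K : Type) [Field K] [NumberField K] (hK : IsImaginaryQuadratic K) (hdK : NumberField.discr K = -239)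
    {Wd : WeierstrassCurve ℚ} [Wd.IsElliptic] [Wd.IsGloballyMinimal] (hWdeq : Wd = (⟨1, (-1), 0, (-721586983794), 236394297725209300⟩ : WeierstrassCurve ℚ))
    (hrd : Wd.analyticRank = 1) {qd : ℚ} (hqd : shaAn Wd = (qd : ℂ)) (hvd : padicValRat 3 qd ≤ 0) :
    MissingUpperBoundAt W 3 := by
  have hI : integralModelInt W = (⟨1, -1, 0, -12632604, -17312657840⟩ : WeierstrassCurve ℤ) := by
    subst hWeq; exact integralModelInt_eq_of_map_eq _ (map_mk_int 1 (-1) 0 (-12632604) (-17312657840))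
  have hns : ¬ (∀ n : ℕ, W.HasSurjectiveModNGaloisRep (3 ^ n : ℕ)) := fun h =>
    notSurjThree_g32670k1 hI (by simpa using h 1)
  exact missingUpperBoundAt_g32670k1_3_tam hGZ hKo hMN hGZK hmod hJ2 hWeq hN hr hns D hopt hc K hK hdK hWdeq hrd hqd hvd

/-! ### `32670j1`: `Δ = -107307307008000 = (-47520)³` — mod-3 image inside a Cartan normaliser, certified in the kernel -/

/-- **`ρ̄_(E,3)` is NOT surjective for `E = 32670j1`** (kernel: `Δ(E) = (-47520)³` on the integral model `[1, -1, 0, 11676, -115120]`; Serre: `ℚ(E[3]) ⊇ ℚ(μ₃, ∛Δ)`, so a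
surjective image forces `Δ ∉ ℚ׳`; tree THEOREM `ModThreeImage.not_hasSurjectiveModNGaloisRep_three_of_Δ_eq_cube`). [cite: Serre1972, §5.3]
[cite: SilvermanAEC2009, III.1] [cite: Cremona2006, Table 1 (Cremona label 32670j1)] -/
theorem notSurjThree_g32670j1 {W : WeierstrassCurve ℚ} [W.IsElliptic] [W.IsGloballyMinimal]
    (hI : integralModelInt W = (⟨1, -1, 0, 11676, -115120⟩ : WeierstrassCurve ℤ)) : ¬ W.HasSurjectiveModNGaloisRep 3 := by
  have hD : discOf [1, (-1), 0, 11676, (-115120)] = (-107307307008000) := by decide +kernel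
  have hΔ : W.Δ = (((-107307307008000) : ℤ) : ℚ) := by rw [Δ_eq_cast hI, intCurve_Δ, hD]
  exact ModThreeImage.not_hasSurjectiveModNGaloisRep_three_of_Δ_eq_cube W (d := (((-47520) : ℤ) : ℚ)) (by rw [hΔ]; norm_num)

/-- **RECORD `32670j1` @ `3` with the image binder `hns` AND the Tamagawa binders DISCHARGED** — `missingUpperBoundAt_g32670j1_3_tam` (file
`…RecordsSharpTam03`) with `hns` supplied by `notSurjThree_g32670j1` (`n = 1`). Remaining displayed: named facts + schema, Cremona's `N`, `r_an = 0`,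
the lattice-optimal datum with `3 ∤ c(D)`, the field, the twist numerics. Per pair; nothing booked; BSD is not proved by this.
[cite: Serre1972, §5.3] [cite: Jetchev2008, Cor. 1.5] [cite: Miller2011LMS, Def. 1.1] [cite: Cremona2006, Table 1 (Cremona label 32670j1)] -/
theorem missingUpperBoundAt_g32670j1_3_img
    (hGZ : ∀ (N : ℕ) [NeZero N] (W : WeierstrassCurve ℚ) (K : Type) [Field K] [NumberField K],
      gross_zagier N W K)
    (hKo : ∀ (N : ℕ) [NeZero N] (W : WeierstrassCurve ℚ) (K : Type) [Field K] [NumberField K],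
      kolyvagin N W K)
    (hMN : ∀ (N : ℕ) [NeZero N] (W : WeierstrassCurve ℚ) (K : Type) [Field K] [NumberField K],
      MatarNekovar2019.thm03_padicValNat_card_sha_le_of_irreducible N W K)
    (hGZK : rank_eq_analyticRank_of_analyticRank_le_one) (hmod : hasEntireLFunction_rat)
    (hJ2 : ∀ (N : ℕ) [NeZero N] (W : WeierstrassCurve ℚ) [W.IsElliptic] [W.IsGloballyMinimal]
      (K : Type) [Field K] [NumberField K],
      IsImaginaryQuadratic K → NumberField.discr K ≠ -3 → NumberField.discr K ≠ -4 →
      SatisfiesHeegnerHypothesis N K → SatisfiesHeegnerHypothesis 2 K →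
      ∀ (p : ℕ) [Fact p.Prime], p ≠ 2 → W.analyticRank = 0 → Addv W p → 0 ≤ padicValRat p W.j →
      ¬ W.HasCM → W.HasIrreducibleModPGaloisRep p →
      ¬ (∀ n : ℕ, W.HasSurjectiveModNGaloisRep (p ^ n : ℕ)) →
      (∃ Dt : ModularParametrizationData W N,
        (∀ z ∈ Dt.L.lattice, ∃ w ∈ periodLattice Dt.f, z = (Dt.c : ℂ) * w) ∧ ¬ (p : ℤ) ∣ Dt.c) →
      ¬ p ∣ (W.baseChange ℚ_[p]).localTamagawaNumber ℤ_[p] →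
      (∀ (q' : ℕ) [Fact q'.Prime], q' ∣ N →
        p ∣ (W.baseChange ℚ_[q']).localTamagawaNumber ℤ_[q'] → ¬ q' ^ 2 ∣ N) →
      ∀ {P : (W.baseChange K).toAffine.Point}, IsHeegnerPoint N W K P → ¬ IsOfFinAddOrder P →
      ∀ (q : ℕ) [Fact q.Prime], q ∣ N → ¬ q ^ 2 ∣ N → q ≠ p →
      padicValNat p (Nat.card (AddCommGroup.primaryComponent (W.baseChange K).sha p)) +
          2 * padicValNat p ((W.baseChange ℚ_[q]).localTamagawaNumber ℤ_[q]) ≤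
        2 * padicValNat p (AddSubgroup.zmultiples P).index)
    {W : WeierstrassCurve ℚ} [W.IsElliptic] [W.IsGloballyMinimal] (hWeq : W = (⟨1, (-1), 0, 11676, (-115120)⟩ : WeierstrassCurve ℚ))
    (hN : W.conductorNorm ℤ = 32670) (hr : W.analyticRank = 0)
    (D : ModularParametrizationData W 32670) (hopt : ∀ z ∈ D.L.lattice, ∃ w ∈ periodLattice D.f, z = (D.c : ℂ) * w)
    (hc : ¬ (3 : ℤ) ∣ D.c)
    (K : Type) [Field K] [NumberField K] (hK : IsImaginaryQuadratic K) (hdK : NumberField.discr K = -239)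
    {Wd : WeierstrassCurve ℚ} [Wd.IsElliptic] [Wd.IsGloballyMinimal] (hWdeq : Wd = (⟨1, (-1), 0, 666934086, 1531592656820⟩ : WeierstrassCurve ℚ))
    (hrd : Wd.analyticRank = 1) {qd : ℚ} (hqd : shaAn Wd = (qd : ℂ)) (hvd : padicValRat 3 qd ≤ 0) :
    MissingUpperBoundAt W 3 := by
  have hI : integralModelInt W = (⟨1, -1, 0, 11676, -115120⟩ : WeierstrassCurve ℤ) := by
    subst hWeq; exact integralModelInt_eq_of_map_eq _ (map_mk_int 1 (-1) 0 11676 (-115120))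
  have hns : ¬ (∀ n : ℕ, W.HasSurjectiveModNGaloisRep (3 ^ n : ℕ)) := fun h =>
    notSurjThree_g32670j1 hI (by simpa using h 1)
  exact missingUpperBoundAt_g32670j1_3_tam hGZ hKo hMN hGZK hmod hJ2 hWeq hN hr hns D hopt hc K hK hdK hWdeq hrd hqd hvd

/-! ### `32670bq1`: `Δ = 63664587657000 = (39930)³` — mod-3 image inside a Cartan normaliser, certified in the kernel -/

/-- **`ρ̄_(E,3)` is NOT surjective for `E = 32670bq1`** (kernel: `Δ(E) = (39930)³` on the integral model `[1, -1, 1, -12728, -394413]`; Serre: `ℚ(E[3]) ⊇ ℚ(μ₃, ∛Δ)`, so a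
surjective image forces `Δ ∉ ℚ׳`; tree THEOREM `ModThreeImage.not_hasSurjectiveModNGaloisRep_three_of_Δ_eq_cube`). [cite: Serre1972, §5.3]
[cite: SilvermanAEC2009, III.1] [cite: Cremona2006, Table 1 (Cremona label 32670bq1)] -/
theorem notSurjThree_g32670bq1 {W : WeierstrassCurve ℚ} [W.IsElliptic] [W.IsGloballyMinimal]
    (hI : integralModelInt W = (⟨1, -1, 1, -12728, -394413⟩ : WeierstrassCurve ℤ)) : ¬ W.HasSurjectiveModNGaloisRep 3 := by
  have hD : discOf [1, (-1), 1, (-12728), (-394413)] = 63664587657000 := by decide +kernel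
  have hΔ : W.Δ = ((63664587657000 : ℤ) : ℚ) := by rw [Δ_eq_cast hI, intCurve_Δ, hD]
  exact ModThreeImage.not_hasSurjectiveModNGaloisRep_three_of_Δ_eq_cube W (d := ((39930 : ℤ) : ℚ)) (by rw [hΔ]; norm_num)

/-- **RECORD `32670bq1` @ `3` with the image binder `hns` AND the Tamagawa binders DISCHARGED** — `missingUpperBoundAt_g32670bq1_3_tam` (file
`…RecordsSharpTam03`) with `hns` supplied by `notSurjThree_g32670bq1` (`n = 1`). Remaining displayed: named facts + schema, Cremona's `N`, `r_an = 0`,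
the lattice-optimal datum with `3 ∤ c(D)`, the field, the twist numerics. Per pair; nothing booked; BSD is not proved by this.
[cite: Serre1972, §5.3] [cite: Jetchev2008, Cor. 1.5] [cite: Miller2011LMS, Def. 1.1] [cite: Cremona2006, Table 1 (Cremona label 32670bq1)] -/
theorem missingUpperBoundAt_g32670bq1_3_img
    (hGZ : ∀ (N : ℕ) [NeZero N] (W : WeierstrassCurve ℚ) (K : Type) [Field K] [NumberField K],
      gross_zagier N W K)
    (hKo : ∀ (N : ℕ) [NeZero N] (W : WeierstrassCurve ℚ) (K : Type) [Field K] [NumberField K],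
      kolyvagin N W K)
    (hMN : ∀ (N : ℕ) [NeZero N] (W : WeierstrassCurve ℚ) (K : Type) [Field K] [NumberField K],
      MatarNekovar2019.thm03_padicValNat_card_sha_le_of_irreducible N W K)
    (hGZK : rank_eq_analyticRank_of_analyticRank_le_one) (hmod : hasEntireLFunction_rat)
    (hJ2 : ∀ (N : ℕ) [NeZero N] (W : WeierstrassCurve ℚ) [W.IsElliptic] [W.IsGloballyMinimal]
      (K : Type) [Field K] [NumberField K],
      IsImaginaryQuadratic K → NumberField.discr K ≠ -3 → NumberField.discr K ≠ -4 →
      SatisfiesHeegnerHypothesis N K → SatisfiesHeegnerHypothesis 2 K →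
      ∀ (p : ℕ) [Fact p.Prime], p ≠ 2 → W.analyticRank = 0 → Addv W p → 0 ≤ padicValRat p W.j →
      ¬ W.HasCM → W.HasIrreducibleModPGaloisRep p →
      ¬ (∀ n : ℕ, W.HasSurjectiveModNGaloisRep (p ^ n : ℕ)) →
      (∃ Dt : ModularParametrizationData W N,
        (∀ z ∈ Dt.L.lattice, ∃ w ∈ periodLattice Dt.f, z = (Dt.c : ℂ) * w) ∧ ¬ (p : ℤ) ∣ Dt.c) →
      ¬ p ∣ (W.baseChange ℚ_[p]).localTamagawaNumber ℤ_[p] →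
      (∀ (q' : ℕ) [Fact q'.Prime], q' ∣ N →
        p ∣ (W.baseChange ℚ_[q']).localTamagawaNumber ℤ_[q'] → ¬ q' ^ 2 ∣ N) →
      ∀ {P : (W.baseChange K).toAffine.Point}, IsHeegnerPoint N W K P → ¬ IsOfFinAddOrder P →
      ∀ (q : ℕ) [Fact q.Prime], q ∣ N → ¬ q ^ 2 ∣ N → q ≠ p →
      padicValNat p (Nat.card (AddCommGroup.primaryComponent (W.baseChange K).sha p)) +
          2 * padicValNat p ((W.baseChange ℚ_[q]).localTamagawaNumber ℤ_[q]) ≤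
        2 * padicValNat p (AddSubgroup.zmultiples P).index)
    {W : WeierstrassCurve ℚ} [W.IsElliptic] [W.IsGloballyMinimal] (hWeq : W = (⟨1, (-1), 1, (-12728), (-394413)⟩ : WeierstrassCurve ℚ))
    (hN : W.conductorNorm ℤ = 32670) (hr : W.analyticRank = 0)
    (D : ModularParametrizationData W 32670) (hopt : ∀ z ∈ D.L.lattice, ∃ w ∈ periodLattice D.f, z = (D.c : ℂ) * w)
    (hc : ¬ (3 : ℤ) ∣ D.c)
    (K : Type) [Field K] [NumberField K] (hK : IsImaginaryQuadratic K) (hdK : NumberField.discr K = -431)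
    {Wd : WeierstrassCurve ℚ} [Wd.IsElliptic] [Wd.IsGloballyMinimal] (hWdeq : Wd = (⟨1, (-1), 1, (-2364307958), 31833208461981⟩ : WeierstrassCurve ℚ))
    (hrd : Wd.analyticRank = 1) {qd : ℚ} (hqd : shaAn Wd = (qd : ℂ)) (hvd : padicValRat 3 qd ≤ 0) :
    MissingUpperBoundAt W 3 := by
  have hI : integralModelInt W = (⟨1, -1, 1, -12728, -394413⟩ : WeierstrassCurve ℤ) := by
    subst hWeq; exact integralModelInt_eq_of_map_eq _ (map_mk_int 1 (-1) 1 (-12728) (-394413))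
  have hns : ¬ (∀ n : ℕ, W.HasSurjectiveModNGaloisRep (3 ^ n : ℕ)) := fun h =>
    notSurjThree_g32670bq1 hI (by simpa using h 1)
  exact missingUpperBoundAt_g32670bq1_3_tam hGZ hKo hMN hGZK hmod hJ2 hWeq hN hr hns D hopt hc K hK hdK hWdeq hrd hqd hvd

end Summit.BirchSwinnertonDyer.BirchSwinnertonDyer.Theorems.WildUpperUnitTwistRecords

end
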